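import Literature.MathematicalPhysics.QuantumFieldTheory.Balaban1983to89.B8Ineq132

/-!
# `Balaban1983to89.B8Eq131Cubes` — B8 p. 98 and (1.131) p. 99: the family of cubes
# `□ ⊂ □_k ⊂ □_{k−1} ⊂ … ⊂ □₀ ⊂ □̃`, the sets `Λ′_j` and `ℭ_k`, and (1.132)/(1.133) for THIS family

T. Bałaban, *Spaces of regular gauge field configurations on a lattice and gauge fixing conditions*, Commun.
Math. Phys. **99** (1985) 75–102 `[Balaban1985RegularSpaces]` ("B8"), Sect. A p. 77 (displays (1.3), (1.4)),
Sect. F p. 98 (the construction of `□`, `□_j`, `□̃`) and p. 99 (displays (1.131)–(1.133)).  STATUS: a published,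
refereed paper; this file TYPES the printed geometric objects of p. 98 / (1.131) as concrete boxes on the `ℤ^d`
tower of `B8Ineq130` (`tlo`/`thi`) and PROVES the geometric bookkeeping print states in words, then SPECIALISES the
tree's certified (1.132)/(1.133) (`B8Ineq132.ineq132`, whose cube family, collar and `ℭ` were abstract hypotheses)
to this family; nothing here is new mathematics and nothing here is a claim about the Clay problem.

## THE PRINTED TEXT (quoted from the page images of pp. 77, 98, 99)

* p. 77, (1.3)–(1.4): "We consider a sequence of domains … `Ω₀ ⊃ Ω₁ ⊃ Ω₂ ⊃ … ⊃ Ω_k`, `Ω_j ⊂ T_η`,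
  `j = 0, 1, …, k`, (1.3) which satisfy the following conditions: `Ω_j = Bʲ(Ω_j^{(j)})`, `Ω_j` is a sum of cubes
  of a size `M₁Lʲη`, `(Lʲη)^{−1} dist(Ω_jᶜ, Ω_{j+1}) > RM₁`. (1.4)"
* p. 98: "Now let us take a cube `□ ⊂ Ω₀` for which we want to prove the condition (3.35). A size of this cube
  depends on an index `j` indicating a scale we are interested in. We assume that the cube `□` is contained in
  `Ω_j`, and not in `Ω_{j+1}`. Further, we assume that it is a union of cubes of the size `R₁M₁Lʲη`, where `R₁`,
  `M₁` are smallest integers for which all the theorems of the papers [2, 4] are valid. … Having in view future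
  applications we take a size of `□` equal to `MLʲη`, where `M` is a multiple of `R₁M₁`. Without a loss of
  generality we can assume also that `j = k` … so we can assume that `k ≥ 1`.
  Let us take a sequence of cubes `□₀, □₁, …, □_{k−1}, □_k, □`, such that `□_j ⊃ □_{j+1}` and a distance between
  boundaries of these cubes is equal to `R₁M₁Lʲη`. Thus a distance of the boundary of `□₀` to `□` is equal to
  `Σ_{j=0}^{k} R₁M₁Lʲη < (1 − L^{−1})^{−1}R₁M₁ ≤ 2R₁M₁`.
  We cover `□₀` by a smallest family of cubes of the size `R₁M₁`. A sum of these cubes is a cube which we denote by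
  `□̃`. A distance of its boundary to `□` is equal to `2R₁M₁`. We assume that `RM` is bigger than `R₁M₁`, for example
  `L^{−1}RM > 2dR₁M₁`, thus we have `□̃ ⊂ Ω_{k−1}`. Of course we assume also that these constructions are compatible
  with the block structure of the lattice `T`, i.e. for every `j` the cube `□_j` is a sum of the big blocks of the
  lattice `T_{L^{−j}}`. … where `y` is a center of `□̃^{(k)}`."
* p. 99: "The sequence of cubes `{□_j}` is an admissible family of subsets satisfying (1.3), (1.4),
  `□_k ⊂ Ω_{k−1}`, `□_j ⊂ Ω_j`, `j < k`. Let us define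
  `Λ′_j = □_j^{(j)} \ □_{j+1}^{(j)}`, `j = 1, …, k − 1`, `Λ′_k = □_k^{(k)}`, `Λ′₀ = T \ □₁`, `ℭ_k = ⋃_{j=0}^{k} Λ′_j`, (1.131)
  and let us define a configuration `U₀″` as equal to `U₀′` on `□̃`, and equal to `1` outside `□̃`. It satisfies the
  conditions `U₀″ ∈ 𝔄_k({□_j}, L³α₀) ∩ Ax_k(ℭ_k, 1)`, (1.132) `|Ū₀″ʲ − 1| < 6dL²Mα₀` on `□_j^{(j)}`,
  `j = 0, 1, …, k`, (1.133) by the construction of `U₀″`, and the inequality (1.130)."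

## WHAT IS CERTIFIED HERE (kernel, axioms `propext`/`Classical.choice`/`Quot.sound` only)

Units: the unit lattice is `T₁^{(k)}` (depth `0` of the tower); depth `n` is the `Lⁿ`-times finer lattice; the
fine lattice `T_η` is depth `k`; `ρ` stands for the integer `R₁M₁`; `a ∈ ℤ^d` is the lower corner and `M` the side
of `□^{(k)}` (so `□` has side `MLᵏη`).
* §0–§1 the objects: `gs L n = Σ_{i≤n} Lⁱ`; margin boxes `bLo`/`bHi` (= `□^{(depth n)}` widened by `m`); `□̃^{(k)} =
  [tLo, tHi] = [a − 2ρ, a + M − 1 + 2ρ]^d` ("distance of its boundary to `□` is equal to `2R₁M₁`");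
  `□_j^{(j)} = [sqLo j, sqHi j]` = `□^{(j)}` widened by `ρ·gs L (k − j) = R₁M₁Σ_{i=j}^{k}L^{i−j}`; `□_{j+1}^{(j)} =
  [inLo j, inHi j]` (widened by `R₁M₁Σ_{i=j+1}^{k}L^{i−j}`; `inner_eq_blowup`: it IS `B(□_{j+1}^{(j+1)})`, and
  `inner_top`: for `j = k` it is `□^{(k)}`); the fine-lattice sets `box = □`, `cube j = □_j = Bʲ(□_j^{(j)})`,
  `tcube = □̃`; **`LamP j = Λ′_j`** exactly as (1.131) (`T \ □₁` for `j = 0`, `□_j^{(j)} \ □_{j+1}^{(j)}` for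
  `1 ≤ j < k`, `□_k^{(k)}` for `j = k`); the centre `ctr = a + ⌊(M − 1)/2⌋` and radius `crad = ⌊M/2⌋ + 2ρ` of `□̃^{(k)}`.
* §2 the printed distances as identities of the fine margins `m_j = Lʲ·ρ·gs L (k − j) = R₁M₁Σ_{i=j}^{k}Lⁱ`:
  `margin_succ` (`m_j = m_{j+1} + R₁M₁Lʲ`: "a distance between boundaries of these cubes is equal to `R₁M₁Lʲη`"),
  `margin_top` (`m_k = R₁M₁Lᵏ`), `margin_zero` (`m₀ = Σ_{j=0}^{k}R₁M₁Lʲ`), `margin_collar`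
  ("`< (1 − L^{−1})^{−1}R₁M₁ ≤ 2R₁M₁`" as `m_j + 1 ≤ 2R₁M₁Lᵏ`), `margin_own`.
* §3 the inclusions: `cube_succ_subset` (`□_{j+1} ⊂ □_j`), `box_subset_cube_top` (`□ ⊂ □_k`), `cube_anti`,
  `box_subset_cube`, `cube_subset_tcube` (`□_j ⊂ □̃`), **`collar_cube`** (every site within sup-distance `1` of `□_j`
  lies in `□̃` — the hypothesis `hcol` of `B8Ineq132.ineq132`), `sq_le_tilde` (`□_j^{(j)} ⊂ □̃^{(j)}`), **`lamP_subset`**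
  (`Λ′_j ⊂ □̃^{(j)}`, `1 ≤ j ≤ k` — the hypothesis `hΛ`), `box_subset_lamP_top` (`□^{(k)} ⊂ Λ′_k`).
* §4 **block compatibility** `mem_cube_iff`: `x ∈ □_j ⟺` the `Lʲ`-block of `x` is a block of `□_j^{(j)}` ("for every
  `j` the cube `□_j` is a sum of the big blocks of the lattice `T_{L^{−j}}`"), with `flm`/`under_flm`.
* §5 `ctr_mem`, `two_crad_le`, `tLo_le_tHi`: the hypotheses `hy`, `hy'`, `hrad`, `hside`, `hlohi` of `B8Ineq133.ineq133`.
* §6 **`tcube_subset_of_sep`**: "thus we have `□̃ ⊂ Ω_{k−1}`" PROVED from `□ ⊂ Ω_k`, the separation (1.4) at level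
  `k − 1` and `2dR₁M₁·L < RM₁` (`k ≥ 1`, `M ≥ 1`); **`cube_subset_Omega`**: "`□_k ⊂ Ω_{k−1}`, `□_j ⊂ Ω_j`, `j < k`"
  PROVED from `□̃ ⊂ Ω_{k−1}` and the nesting (1.3).
* §7 **`ineq132_cubes`**: (1.132) `U₀″ ∈ 𝔄_k({□_j}, L³α₀) ∩ Ax_k(ℭ_k, 1)` and (1.133) on the bonds of `□_j^{(j)}`,
  `j = 0, …, k`, for the cut-off configuration `U₀″ = B8Ineq133.cutFixed` over `□̃^{(k)}` with centre `ctr` (every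
  orbit, every `AvgClosed` gauge group), from `U₀ ∈ 𝔄_k({Ω_j}, α₀)` (`B8Ineq132.InAk`), `□̃ ⊂ Ω_{k−1}`, `1 ≤ R₁M₁ ≤ M`,
  `11d < M` and the smallness of `α₀` — all geometric hypotheses of `B8Ineq132.ineq132` discharged by §2–§5;
  `ineq132_cubes_of_sep`: the same with `□̃ ⊂ Ω_{k−1}` replaced by its printed derivation (§6).

## DICTIONARY / HONEST SCOPE

* `T_η` ↦ `ℤ^d` (the lineage's tower, `B8Ineq130` header); `Λ′₀ = T \ □₁` is the complement in `ℤ^d`; (1.19) puts no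
  condition on `Λ′₀` (`B8Ineq132.InAxOne` quantifies `1 ≤ j ≤ k`).
* `□̃` is DEFINED as `□` widened by `2R₁M₁` unit-lattice units on every side — print's stated property ("A distance of
  its boundary to `□` is equal to `2R₁M₁`") of the smallest cover of `□₀` by `R₁M₁`-cubes; the cover itself, the
  `R₁M₁`-grid, "`□` is a union of cubes of the size `R₁M₁Lᵏη`" and "`M` is a multiple of `R₁M₁`" are NOT typed (they
  are not used by (1.132)/(1.133)); only `1 ≤ R₁M₁ ≤ M` enters.
* (1.4)'s "dist" is read in the `ℓ¹` metric of `ℤ^d` in fine units (`l1dist`) — the weakest reading (`|·|_∞ ≤ |·|₂ ≤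
  |·|₁`), so the Euclidean or sup-norm form of (1.4) implies the hypothesis `hsep`; p. 98's "`L^{−1}RM > 2dR₁M₁`" is
  read with the `RM₁` of (1.4) (`hR : 2dR₁M₁L < RM₁`).
* NOT asserted: that `{□_j}` itself satisfies (1.4) (print: "an admissible family of subsets satisfying (1.3), (1.4)"
  — its boundary separations are `R₁M₁Lʲη`, i.e. (1.4) with `R₁M₁` for `RM₁`; only the nesting and the block
  structure are proved here); the `L³α₀` thresholds, `Ax_k` at `U₀ = 1`, strict/non-strict inequalities and the explicit
  smallness hypotheses are exactly those of `B8Ineq132`/`B8Ineq133` (see their HONEST SCOPE); Theorem 4 ⇒ (1.134) and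
  Prop. 6 are untouched.
-/

noncomputable section

open scoped BigOperators
open Finset

namespace Literature.MathematicalPhysics.QuantumFieldTheory.Balaban1983to89.B8Eq131Cubes

open B7Prop1Explicit B7Prop2Explicit B7Prop1Local B7AvgGaugeCovariance B8Ineq130 B8Eq115GaugeFixing B8Ineq133
  B8Ineq132

export B7Prop1Explicit (Site)

variable {d : ℕ}

section Geometry

/-! ## §0. Geometric sums and boxes with a margin -/

/-- `gs L n = Σ_{i=0}^{n} Lⁱ` (the number of `Lʲη`-units in `Σ_{i=j}^{j+n} R₁M₁Lⁱη / (R₁M₁Lʲη)`). [folklore] -/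
def gs (L n : ℕ) : ℕ := ∑ i ∈ range (n + 1), L ^ i

/-- `gs L 0 = 1`. [folklore] -/
@[simp] theorem gs_zero (L : ℕ) : gs L 0 = 1 := by simp [gs]

/-- `gs L (n + 1) = L · gs L n + 1`. [folklore] -/
theorem gs_succ (L n : ℕ) : gs L (n + 1) = L * gs L n + 1 := by
  unfold gs
  rw [Finset.sum_range_succ', Finset.mul_sum]
  simp [pow_succ, mul_comm]

/-- `1 ≤ gs L n`. [folklore] -/
theorem one_le_gs (L n : ℕ) : 1 ≤ gs L n := by
  unfold gs
  have h : L ^ 0 ≤ ∑ i ∈ range (n + 1), L ^ i :=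
    Finset.single_le_sum (f := fun i => L ^ i) (fun i _ => Nat.zero_le _) (by simp)
  simpa using h

/-! p. 98's "`Σ_{j=0}^{k} R₁M₁Lʲη < (1 − L⁻¹)⁻¹R₁M₁ ≤ 2R₁M₁`" in the integer form `gs L n + 1 ≤ 2Lⁿ` (`L ≥ 2`) is the
tree's `B8Ineq132.geom_margin` (used below by name). -/

/-- The box of the depth-`n` lattice obtained from `□^{(depth n)} = [Lⁿa, Lⁿ(a + M) − 1]^d` by adding a margin `m`
on every side: lower corner. [folklore] -/
def bLo (L : ℕ) (a : Site d) (n m : ℕ) : Site d := fun i => (L : ℤ) ^ n * a i - m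

/-- Upper corner of the same box. [folklore] -/
def bHi (L : ℕ) (a : Site d) (M n m : ℕ) : Site d := fun i => (L : ℤ) ^ n * (a i + M) - 1 + m

/-- Blowing a margin box up by `Lᵖ` (the tower map `tlo` of `B8Ineq130`) multiplies the margin by `Lᵖ`.
[folklore] -/
theorem tlo_bLo (L : ℕ) (a : Site d) (n m p : ℕ) : tlo L (bLo L a n m) p = bLo L a (n + p) (L ^ p * m) := by
  funext i
  rw [tlo_apply]
  simp only [bLo]
  push_cast
  ring

/-- Same for the upper corner (`thi`). [folklore] -/
theorem thi_bHi (L : ℕ) (a : Site d) (M n m p : ℕ) :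
    thi L (bHi L a M n m) p = bHi L a M (n + p) (L ^ p * m) := by
  funext i
  rw [thi_apply]
  simp only [bHi]
  push_cast
  ring

/-- A box with a smaller margin lies in the box with a larger margin. [folklore] -/
theorem inBox_margin_mono {L : ℕ} {a : Site d} {M n m m' : ℕ} (h : m ≤ m') {x : Site d}
    (hx : InBox (bLo L a n m) (bHi L a M n m) x) : InBox (bLo L a n m') (bHi L a M n m') x := by
  intro i
  obtain ⟨h1, h2⟩ := hx i
  simp only [bLo, bHi] at h1 h2 ⊢
  have hm : (m : ℤ) ≤ m' := by exact_mod_cast h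
  constructor <;> linarith

/-- Componentwise form of the same monotonicity. [folklore] -/
theorem le_of_margin_mono {L : ℕ} {a : Site d} {M n m m' : ℕ} (h : m ≤ m') :
    bLo L a n m' ≤ bLo L a n m ∧ bHi L a M n m ≤ bHi L a M n m' := by
  have hm : (m : ℤ) ≤ m' := by exact_mod_cast h
  constructor <;> intro i <;> simp only [bLo, bHi] <;> linarith

/-! ## §1. The printed objects of p. 98 and (1.131): `□`, `□_j`, `□̃`, `Λ′_j` -/

/-- Lower corner of `□̃^{(k)}` on the unit lattice `T₁^{(k)}`: `a − 2R₁M₁` ("A distance of its boundary to `□` is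
equal to `2R₁M₁`", p. 98; `a` = lower corner of `□^{(k)}`, `ρ = R₁M₁`). [cite: Balaban1985RegularSpaces, p.98 ("A distance of its boundary to □ is equal to 2R₁M₁")] -/
def tLo (a : Site d) (ρ : ℕ) : Site d := fun i => a i - 2 * ρ

/-- Upper corner of `□̃^{(k)}`: `a + M − 1 + 2R₁M₁`. [cite: Balaban1985RegularSpaces, p.98 ("A distance of its boundary to □ is equal to 2R₁M₁")] -/
def tHi (a : Site d) (M ρ : ℕ) : Site d := fun i => a i + M - 1 + 2 * ρ

/-- `tLo` is the margin-`2ρ` box at depth `0`. [folklore] -/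
theorem tLo_eq (L : ℕ) (a : Site d) (ρ : ℕ) : tLo a ρ = bLo L a 0 (2 * ρ) := by
  funext i; simp [tLo, bLo]

/-- `tHi` is the margin-`2ρ` box at depth `0`. [folklore] -/
theorem tHi_eq (L : ℕ) (a : Site d) (M ρ : ℕ) : tHi a M ρ = bHi L a M 0 (2 * ρ) := by
  funext i; simp [tHi, bHi]

/-- Lower corner of `□_j^{(j)}` (the cube `□_j` traced on its own lattice `T^{(j)}`, depth `k − j`): margin
`R₁M₁·Σ_{i=j}^{k} L^{i−j} = ρ·gs L (k − j)` around `□^{(j)}` ("a distance between boundaries of these cubes is equal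
to `R₁M₁Lʲη`", p. 98). [cite: Balaban1985RegularSpaces, p.98 ("□_j ⊃ □_{j+1} and a distance between boundaries of these cubes is equal to R₁M₁Lʲη")] -/
def sqLo (L : ℕ) (a : Site d) (ρ k j : ℕ) : Site d := bLo L a (k - j) (ρ * gs L (k - j))

/-- Upper corner of `□_j^{(j)}`. [cite: Balaban1985RegularSpaces, p.98 ("□_j ⊃ □_{j+1} and a distance between boundaries of these cubes is equal to R₁M₁Lʲη")] -/
def sqHi (L : ℕ) (a : Site d) (M ρ k j : ℕ) : Site d := bHi L a M (k - j) (ρ * gs L (k - j))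

/-- Lower corner of `□_{j+1}^{(j)}` (the next cube traced on `T^{(j)}`; for `j = k` this is `□^{(k)}`, "`□_{k+1} = □`"):
margin `ρ·(gs L (k − j) − 1) = R₁M₁·Σ_{i=j+1}^{k} L^{i−j}`. [cite: Balaban1985RegularSpaces, (1.131) p.99] -/
def inLo (L : ℕ) (a : Site d) (ρ k j : ℕ) : Site d := bLo L a (k - j) (ρ * (gs L (k - j) - 1))

/-- Upper corner of `□_{j+1}^{(j)}`. [cite: Balaban1985RegularSpaces, (1.131) p.99] -/
def inHi (L : ℕ) (a : Site d) (M ρ k j : ℕ) : Site d := bHi L a M (k - j) (ρ * (gs L (k - j) - 1))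

/-- `□` as a set of sites of `T_η` (depth `k`): `[Lᵏa, Lᵏ(a + M) − 1]^d`, side `MLᵏη` ("we take a size of `□` equal
to `MLʲη`", `j = k`). [cite: Balaban1985RegularSpaces, p.98 ("we take a size of □ equal to MLʲη")] -/
def box (L : ℕ) (a : Site d) (M k : ℕ) : Set (Site d) := {x | InBox (bLo L a k 0) (bHi L a M k 0) x}

/-- `□_j` as a set of sites of `T_η` (depth `k`), `j ≤ k`: the `Lʲ`-blow-up of `□_j^{(j)}` ("for every `j` the cube
`□_j` is a sum of the big blocks of the lattice `T_{L^{−j}}`", p. 98). [cite: Balaban1985RegularSpaces, p.98 ("for every j the cube □_j is a sum of the big blocks of the lattice T_{L^{-j}}")] -/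
def cube (L : ℕ) (a : Site d) (M ρ k j : ℕ) : Set (Site d) :=
  {x | InBox (tlo L (sqLo L a ρ k j) j) (thi L (sqHi L a M ρ k j) j) x}

/-- `□̃` as a set of sites of `T_η`: the `Lᵏ`-blow-up of `□̃^{(k)} = [a − 2ρ, a + M − 1 + 2ρ]^d` — the top cube
`[lo, hi] = [tLo, tHi]` of the tower of `B8Ineq130`/`B8Eq115GaugeFixing`/`B8Ineq133`. [cite: Balaban1985RegularSpaces, p.98 ("a cube which we denote by □̃")] -/
def tcube (L : ℕ) (a : Site d) (M ρ k : ℕ) : Set (Site d) :=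
  {x | InBox (tlo L (tLo a ρ) k) (thi L (tHi a M ρ) k) x}

/-- **(1.131)** `Λ′_j = □_j^{(j)} \ □_{j+1}^{(j)}` (`1 ≤ j ≤ k − 1`), `Λ′_k = □_k^{(k)}`, `Λ′₀ = T \ □₁` (sites of
`T^{(j)}` = depth `k − j`; `Λ′₀` at depth `k`). [cite: Balaban1985RegularSpaces, (1.131) p.99] -/
def LamP (L : ℕ) (a : Site d) (M ρ k j : ℕ) : Set (Site d) :=
  if j = 0 then {x | x ∉ cube L a M ρ k 1}
  else {z | InBox (sqLo L a ρ k j) (sqHi L a M ρ k j) z ∧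
    (j < k → ¬ InBox (inLo L a ρ k j) (inHi L a M ρ k j) z)}

/-- A centre of `□̃^{(k)}` (print: "`y` is a center of `□̃^{(k)}`", p. 98): `a + ⌊(M − 1)/2⌋`. [cite: Balaban1985RegularSpaces, p.98 ("where y is a center of □̃^{(k)}")] -/
def ctr (a : Site d) (M : ℕ) : Site d := fun i => a i + ((M - 1) / 2 : ℕ)

/-- The radius `h = ⌊M/2⌋ + 2ρ` of `□̃^{(k)}` about `ctr` (`2h ≤ M + 4R₁M₁`). [folklore] -/
def crad (M ρ : ℕ) : ℕ := M / 2 + 2 * ρ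

/-! ## §2. The fine-lattice margins `m_j = R₁M₁·Σ_{i=j}^{k} Lⁱ` and the printed distances -/

/-- Fine-lattice description of `□_j`: the margin-`Lʲ·ρ·gs L (k − j)` box at depth `k`. [folklore] -/
theorem cube_eq {L : ℕ} {a : Site d} {M ρ k j : ℕ} (hj : j ≤ k) :
    cube L a M ρ k j = {x | InBox (bLo L a k (L ^ j * (ρ * gs L (k - j))))
      (bHi L a M k (L ^ j * (ρ * gs L (k - j)))) x} := by
  ext x
  simp only [cube, sqLo, sqHi, tlo_bLo, thi_bHi, Nat.sub_add_cancel hj]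

/-- Fine-lattice description of `□̃`: the margin-`2ρLᵏ` box at depth `k`. [folklore] -/
theorem tcube_eq (L : ℕ) (a : Site d) (M ρ k : ℕ) :
    tcube L a M ρ k = {x | InBox (bLo L a k (L ^ k * (2 * ρ))) (bHi L a M k (L ^ k * (2 * ρ))) x} := by
  ext x
  simp only [tcube, tLo_eq L, tHi_eq L, tlo_bLo, thi_bHi, Nat.zero_add]

/-- `□̃^{(j)}` (depth `n`): `tlo L tLo n = ` the margin-`2ρLⁿ` box, lower corner. [folklore] -/
theorem tlo_tLo (L : ℕ) (a : Site d) (ρ n : ℕ) : tlo L (tLo a ρ) n = bLo L a n (L ^ n * (2 * ρ)) := by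
  rw [tLo_eq L, tlo_bLo, Nat.zero_add]

/-- Upper corner of `□̃^{(j)}`. [folklore] -/
theorem thi_tHi (L : ℕ) (a : Site d) (M ρ n : ℕ) : thi L (tHi a M ρ) n = bHi L a M n (L ^ n * (2 * ρ)) := by
  rw [tHi_eq L, thi_bHi, Nat.zero_add]

/-- The recursion of the margins: `m_j = m_{j+1} + R₁M₁Lʲ` for `j < k` — "a distance between boundaries of these
cubes is equal to `R₁M₁Lʲη`". [cite: Balaban1985RegularSpaces, p.98 ("a distance between boundaries of these cubes is equal to R₁M₁Lʲη")] -/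
theorem margin_succ {L ρ k j : ℕ} (hj : j < k) :
    L ^ j * (ρ * gs L (k - j)) = L ^ (j + 1) * (ρ * gs L (k - (j + 1))) + ρ * L ^ j := by
  obtain ⟨n, hn⟩ : ∃ n, k - j = n + 1 := ⟨k - (j + 1), by omega⟩
  rw [hn, show k - (j + 1) = n by omega, gs_succ, pow_succ]
  ring

/-- `m_k = R₁M₁Lᵏ`: "`□_k ⊃ □`" at distance `R₁M₁Lᵏη`. [cite: Balaban1985RegularSpaces, p.98 ("□_k, □, such that □_j ⊃ □_{j+1}")] -/
theorem margin_top (L ρ k : ℕ) : L ^ k * (ρ * gs L (k - k)) = ρ * L ^ k := by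
  rw [Nat.sub_self, gs_zero, mul_one, mul_comm]

/-- The margins decrease: `m_{j'} ≤ m_j` for `j ≤ j' ≤ k`. [folklore] -/
theorem margin_anti (L ρ k : ℕ) : ∀ (j j' : ℕ), j ≤ j' → j' ≤ k →
    L ^ j' * (ρ * gs L (k - j')) ≤ L ^ j * (ρ * gs L (k - j))
  | j, 0, h, _ => by rw [Nat.le_zero.mp h]
  | j, j' + 1, h, h' => by
    rcases Nat.eq_or_lt_of_le h with rfl | hlt
    · exact le_rfl
    · have ih := margin_anti L ρ k j j' (Nat.lt_succ_iff.mp hlt) (Nat.le_of_succ_le h')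
      rw [margin_succ (Nat.lt_of_succ_le h')] at ih
      exact le_trans (Nat.le_add_right _ _) ih

/-- `m₀ = R₁M₁·Σ_{j=0}^{k} Lʲ`: "a distance of the boundary of `□₀` to `□` is equal to `Σ_{j=0}^{k} R₁M₁Lʲη`".
[cite: Balaban1985RegularSpaces, p.98 (display before (1.128))] -/
theorem margin_zero (L ρ k : ℕ) : L ^ 0 * (ρ * gs L (k - 0)) = ρ * gs L k := by simp

/-- "`… < (1 − L⁻¹)⁻¹R₁M₁ ≤ 2R₁M₁`": every margin satisfies `m_j + R₁M₁ ≤ 2R₁M₁Lᵏ`, in particular `m_j + 1 ≤ 2R₁M₁Lᵏ`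
for `R₁M₁ ≥ 1` (the collar of `□₀` inside `□̃`). [cite: Balaban1985RegularSpaces, p.98 (display before (1.128))] -/
theorem margin_collar {L ρ k j : ℕ} (hL : 2 ≤ L) (hρ : 1 ≤ ρ) (hj : j ≤ k) :
    L ^ j * (ρ * gs L (k - j)) + 1 ≤ L ^ k * (2 * ρ) := by
  have h1 : L ^ j * (ρ * gs L (k - j)) ≤ ρ * gs L k := by
    have := margin_anti L ρ k 0 j (Nat.zero_le j) hj
    simpa using this
  have h2 : gs L k + 1 ≤ 2 * L ^ k := geom_margin hL k
  have h3 : ρ * gs L k + 1 ≤ ρ * (gs L k + 1) := by nlinarith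
  have h4 : ρ * (gs L k + 1) ≤ ρ * (2 * L ^ k) := Nat.mul_le_mul_left _ h2
  calc L ^ j * (ρ * gs L (k - j)) + 1 ≤ ρ * gs L k + 1 := Nat.add_le_add_right h1 1
    _ ≤ ρ * (2 * L ^ k) := h3.trans h4
    _ = L ^ k * (2 * ρ) := by ring

/-- On its own lattice: `ρ·gs L n ≤ 2ρLⁿ` (`□_j^{(j)} ⊂ □̃^{(j)}`). [folklore] -/
theorem margin_own {L ρ : ℕ} (hL : 2 ≤ L) (n : ℕ) : ρ * gs L n ≤ L ^ n * (2 * ρ) := by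
  have h2 : gs L n + 1 ≤ 2 * L ^ n := geom_margin hL n
  calc ρ * gs L n ≤ ρ * (2 * L ^ n) := Nat.mul_le_mul_left _ (by omega)
    _ = L ^ n * (2 * ρ) := by ring

/-! ## §3. The printed inclusions -/

/-- **`□_{j+1} ⊂ □_j`** (`j < k`). [cite: Balaban1985RegularSpaces, p.98 ("□_j ⊃ □_{j+1}")] -/
theorem cube_succ_subset {L : ℕ} {a : Site d} {M ρ k j : ℕ} (hj : j < k) :
    cube L a M ρ k (j + 1) ⊆ cube L a M ρ k j := by
  rw [cube_eq (le_of_lt hj), cube_eq (Nat.succ_le_of_lt hj)]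
  intro x hx
  exact inBox_margin_mono (by rw [margin_succ hj]; exact Nat.le_add_right _ _) hx

/-- **`□ ⊂ □_k`**. [cite: Balaban1985RegularSpaces, p.98 ("□_k, □, such that □_j ⊃ □_{j+1}")] -/
theorem box_subset_cube_top (L : ℕ) (a : Site d) (M ρ k : ℕ) : box L a M k ⊆ cube L a M ρ k k := by
  rw [cube_eq le_rfl]
  intro x hx
  exact inBox_margin_mono (Nat.zero_le _) hx

/-- `□_{j'} ⊂ □_j` for `j ≤ j' ≤ k`. [folklore] -/
theorem cube_anti {L : ℕ} {a : Site d} {M ρ k j j' : ℕ} (h : j ≤ j') (h' : j' ≤ k) :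
    cube L a M ρ k j' ⊆ cube L a M ρ k j := by
  rw [cube_eq h', cube_eq (h.trans h')]
  intro x hx
  exact inBox_margin_mono (margin_anti L ρ k j j' h h') hx

/-- **`□ ⊂ □_j`** for every `j ≤ k`. [folklore] -/
theorem box_subset_cube {L : ℕ} {a : Site d} {M ρ k j : ℕ} (hj : j ≤ k) : box L a M k ⊆ cube L a M ρ k j :=
  (box_subset_cube_top L a M ρ k).trans (cube_anti hj le_rfl)

/-- **`□_j ⊂ □̃`** (`j ≤ k`; print: `□̃` covers `□₀`). [cite: Balaban1985RegularSpaces, p.98 ("We cover □₀ by a smallest family of cubes")] -/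
theorem cube_subset_tcube {L : ℕ} {a : Site d} {M ρ k j : ℕ} (hL : 2 ≤ L) (hρ : 1 ≤ ρ) (hj : j ≤ k) :
    cube L a M ρ k j ⊆ tcube L a M ρ k := by
  rw [cube_eq hj, tcube_eq]
  intro x hx
  exact inBox_margin_mono (Nat.le_of_succ_le (margin_collar hL hρ hj)) hx

/-- The **collar**: every site within sup-distance `1` of `□_j` lies in `□̃` — the distance of `∂□̃` to `□₀` is
`2R₁M₁ − Σ_j R₁M₁L^{j−k} > 0` unit-lattice units, i.e. at least one bond of `T_η` (hypothesis `hcol` of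
`B8Ineq132.ineq132`). [cite: Balaban1985RegularSpaces, p.98 (display before (1.128))] -/
theorem collar_cube {L : ℕ} {a : Site d} {M ρ k j : ℕ} (hL : 2 ≤ L) (hρ : 1 ≤ ρ) (hj : j ≤ k) :
    Collar (cube L a M ρ k j) (tlo L (tLo a ρ) k) (thi L (tHi a M ρ) k) := by
  intro v hv y hy
  rw [cube_eq hj] at hv
  rw [tlo_tLo, thi_tHi]
  have hm := margin_collar hL hρ hj
  set m := L ^ j * (ρ * gs L (k - j)) with hm_def
  have hmz : (m : ℤ) + 1 ≤ ((L ^ k * (2 * ρ) : ℕ) : ℤ) := by exact_mod_cast hm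
  intro i
  obtain ⟨h1, h2⟩ := hv i
  obtain ⟨h3, h4⟩ := hy i
  simp only [bLo, bHi] at h1 h2 ⊢
  constructor <;> linarith

/-- **`□_j^{(j)} ⊂ □̃^{(j)}`** on the `j`-lattice (depth `k − j`), componentwise. [cite: Balaban1985RegularSpaces, (1.133) p.99 ("on □_j^{(j)}")] -/
theorem sq_le_tilde {L : ℕ} (hL : 2 ≤ L) (a : Site d) (M ρ k j : ℕ) :
    tlo L (tLo a ρ) (k - j) ≤ sqLo L a ρ k j ∧ sqHi L a M ρ k j ≤ thi L (tHi a M ρ) (k - j) := by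
  rw [tlo_tLo, thi_tHi]
  exact le_of_margin_mono (margin_own hL (k - j))

/-- **`Λ′_j ⊂ □_j^{(j)} ⊂ □̃^{(j)}`** for `1 ≤ j ≤ k` (hypothesis `hΛ` of `B8Ineq132.ineq132`). [cite: Balaban1985RegularSpaces, (1.131) p.99] -/
theorem lamP_subset {L : ℕ} (hL : 2 ≤ L) (a : Site d) (M ρ k : ℕ) :
    ∀ j, 1 ≤ j → j ≤ k → ∀ x ∈ LamP L a M ρ k j, tlo L (tLo a ρ) (k - j) ≤ x ∧ x ≤ thi L (tHi a M ρ) (k - j) := by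
  intro j hj _ x hx
  have hj0 : j ≠ 0 := by omega
  simp only [LamP, if_neg hj0, Set.mem_setOf_eq] at hx
  obtain ⟨hsq, -⟩ := hx
  obtain ⟨h1, h2⟩ := sq_le_tilde hL a M ρ k j
  exact ⟨fun i => (h1 i).trans (hsq i).1, fun i => (hsq i).2.trans (h2 i)⟩

/-- `Λ′_k = □_k^{(k)} ⊇ □^{(k)}`: the unit-lattice cube itself lies in `ℭ_k` (`k ≥ 1`). [cite: Balaban1985RegularSpaces, (1.131) p.99 ("Λ′_k = □_k^{(k)}")] -/
theorem box_subset_lamP_top {L : ℕ} {a : Site d} {M ρ k : ℕ} (hk : 1 ≤ k) :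
    box L a M 0 ⊆ LamP L a M ρ k k := by
  intro x hx
  have hk0 : k ≠ 0 := by omega
  simp only [LamP, if_neg hk0, Set.mem_setOf_eq, lt_irrefl, IsEmpty.forall_iff, and_true]
  simp only [box, Set.mem_setOf_eq, sqLo, sqHi, Nat.sub_self] at hx ⊢
  exact inBox_margin_mono (Nat.zero_le _) hx

/-- `□_{j+1}^{(j)} = B(□_{j+1}^{(j+1)})`: the inner box of `Λ′_j` is the `L`-blow-up (`tlo`/`thi` one step) of
`□_{j+1}` traced on its own lattice (`j < k`). [cite: Balaban1985RegularSpaces, (1.131) p.99 ("Λ′_j = □_j^{(j)} \\ □_{j+1}^{(j)}")] -/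
theorem inner_eq_blowup {L : ℕ} (a : Site d) (M ρ : ℕ) {k j : ℕ} (hj : j < k) :
    inLo L a ρ k j = tlo L (sqLo L a ρ k (j + 1)) 1 ∧ inHi L a M ρ k j = thi L (sqHi L a M ρ k (j + 1)) 1 := by
  obtain ⟨n, hn⟩ : ∃ n, k - j = n + 1 := ⟨k - (j + 1), by omega⟩
  have hn' : k - (j + 1) = n := by omega
  have hm : ρ * (gs L (n + 1) - 1) = L ^ 1 * (ρ * gs L n) := by
    rw [gs_succ, Nat.add_sub_cancel, pow_one]; ring
  simp only [inLo, inHi, sqLo, sqHi, tlo_bLo, thi_bHi, hn, hn', hm, and_self]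

/-- For `j = k` the inner box is `□^{(k)} = [a, a + M − 1]^d` itself ("`□_{k+1} = □`"). [cite: Balaban1985RegularSpaces, p.98 ("□_k, □")] -/
theorem inner_top (L : ℕ) (a : Site d) (M ρ k : ℕ) :
    inLo L a ρ k k = bLo L a 0 0 ∧ inHi L a M ρ k k = bHi L a M 0 0 := by
  simp [inLo, inHi]

/-! ## §4. Block compatibility: "`□_j` is a sum of the big blocks of the lattice `T_{L^{−j}}`" -/

/-- The `Lᵐ`-coarse site below a fine site. [folklore] -/
def flm (L m : ℕ) (x : Site d) : Site d := fun i => x i / (L : ℤ) ^ m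

/-- `x ∈ Bᵐ(flm x)`. [folklore] -/
theorem under_flm {L : ℕ} (hL : 1 ≤ L) (m : ℕ) (x : Site d) : Under L m (flm L m x) x := by
  intro i
  have hLpos : (0 : ℤ) < (L : ℤ) ^ m := by positivity
  have h1 : x i % (L : ℤ) ^ m + x i / (L : ℤ) ^ m * (L : ℤ) ^ m = x i := Int.emod_add_ediv_mul (x i) _
  have h2 := Int.emod_nonneg (x i) hLpos.ne'
  have h3 := Int.emod_lt_of_pos (x i) hLpos
  simp only [flm]
  constructor <;> linarith

/-- **Block compatibility**: `x ∈ □_j` iff the `Lʲ`-block of `T_η` containing `x` is a block of `□_j^{(j)}`, i.e.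
`□_j = Bʲ(□_j^{(j)})`. [cite: Balaban1985RegularSpaces, p.98 ("for every j the cube □_j is a sum of the big blocks of the lattice T_{L^{-j}}")] -/
theorem mem_cube_iff {L : ℕ} (hL : 1 ≤ L) {a : Site d} {M ρ k j : ℕ} {x : Site d} :
    x ∈ cube L a M ρ k j ↔ ∃ z, InBox (sqLo L a ρ k j) (sqHi L a M ρ k j) z ∧ Under L j z x := by
  constructor
  · intro hx
    refine ⟨flm L j x, ?_, under_flm hL j x⟩
    have hB := under_flm hL j x
    have hL0 : (0 : ℤ) < (L : ℤ) ^ j := by positivity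
    intro i
    obtain ⟨h1, h2⟩ := hx i
    obtain ⟨h3, h4⟩ := hB i
    rw [tlo_apply] at h1
    rw [thi_apply] at h2
    constructor
    · have h5 : (L : ℤ) ^ j * sqLo L a ρ k j i < (L : ℤ) ^ j * (flm L j x i + 1) := by linarith
      exact Int.lt_add_one_iff.mp (lt_of_mul_lt_mul_left h5 hL0.le)
    · have h5 : (L : ℤ) ^ j * flm L j x i < (L : ℤ) ^ j * (sqHi L a M ρ k j i + 1) := by linarith
      exact Int.lt_add_one_iff.mp (lt_of_mul_lt_mul_left h5 hL0.le)
  · rintro ⟨z, hz, hU⟩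
    have hz1 : tlo L (sqLo L a ρ k j) 0 ≤ z := fun i => by rw [tlo_zero]; exact (hz i).1
    have hz2 : z ≤ thi L (sqHi L a M ρ k j) 0 := fun i => by rw [thi_zero]; exact (hz i).2
    have h := under_tower (m := j) hz1 hz2 hU
    rw [Nat.zero_add] at h
    exact inBox_of_le h.1 h.2

/-! ## §5. The centre of `□̃^{(k)}` -/

/-- `tLo ≤ ctr ≤ tHi` and the radius bound `hrad` of `B8Ineq133.ineq133` with `h = ⌊M/2⌋ + 2ρ`. [folklore] -/
theorem ctr_mem {a : Site d} {M ρ : ℕ} (hM : 1 ≤ M) :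
    tLo a ρ ≤ ctr a M ∧ ctr a M ≤ tHi a M ρ ∧
      ∀ i, ctr a M i - tLo a ρ i ≤ crad M ρ ∧ tHi a M ρ i - ctr a M i ≤ crad M ρ := by
  have h1 : ((M - 1) / 2 : ℕ) ≤ M / 2 := Nat.div_le_div_right (Nat.sub_le _ _)
  have h2 : M - 1 - (M - 1) / 2 ≤ M / 2 := by omega
  have h3 : (((M - 1) / 2 : ℕ) : ℤ) ≤ (M : ℤ) - 1 := by
    have : ((M - 1) / 2 : ℕ) ≤ M - 1 := Nat.div_le_self _ _
    omega
  refine ⟨fun i => ?_, fun i => ?_, fun i => ⟨?_, ?_⟩⟩ <;> simp only [tLo, tHi, ctr, crad] <;> push_cast <;> omega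

/-- `2h ≤ M + 4R₁M₁` (hypothesis `hside` of `B8Ineq133.ineq133` with `R₁M₁ ↦ ρ·1`). [folklore] -/
theorem two_crad_le (M ρ : ℕ) : 2 * (crad M ρ : ℝ) ≤ (M : ℝ) + 4 * (ρ : ℝ) * 1 := by
  have h : 2 * crad M ρ ≤ M + 4 * ρ := by unfold crad; omega
  have h' : (2 * crad M ρ : ℝ) ≤ ((M + 4 * ρ : ℕ) : ℝ) := by exact_mod_cast h
  push_cast at h'
  linarith

/-- `tLo ≤ tHi` (`M ≥ 1`). [folklore] -/
theorem tLo_le_tHi {a : Site d} {M ρ : ℕ} (hM : 1 ≤ M) : tLo a ρ ≤ tHi a M ρ := by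
  intro i; simp only [tLo, tHi]; omega

/-! ## §6. The family `{Ω_j}`: "thus we have `□̃ ⊂ Ω_{k−1}`" and "`□_k ⊂ Ω_{k−1}`, `□_j ⊂ Ω_j`, `j < k`" -/

/-- The `ℓ¹`-distance on `ℤ^d` (the weakest reading of "dist" in (1.4): `|·|_∞ ≤ |·|₂ ≤ |·|₁`, so (1.4) stated with
the Euclidean or the sup distance implies the `ℓ¹` form used as a hypothesis below). [folklore] -/
def l1dist (x y : Site d) : ℤ := ∑ i, |x i - y i|

/-- **"thus we have `□̃ ⊂ Ω_{k−1}`"** (p. 98): from `□ ⊂ Ω_k`, the separation (1.4)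
`(L^{k−1}η)^{−1} dist(Ω_{k−1}ᶜ, Ω_k) > RM₁` (fine units, `ℓ¹`) and "`L⁻¹RM > 2dR₁M₁`" (read with (1.4)'s `RM₁`):
every site of `□̃` is within `ℓ¹`-distance `2dR₁M₁Lᵏ` of `□`. [cite: Balaban1985RegularSpaces, p.98 ("for example L⁻¹RM > 2dR₁M₁, thus we have □̃ ⊂ Ω_{k-1}"), (1.4) p.77] -/
theorem tcube_subset_of_sep {L : ℕ} (hL : 1 ≤ L) {a : Site d} {M ρ k : ℕ} (hk : 1 ≤ k) (hM : 1 ≤ M)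
    {Ω : ℕ → Set (Site d)} {R M₁ : ℕ} (hbox : box L a M k ⊆ Ω k)
    (hsep : ∀ x, x ∉ Ω (k - 1) → ∀ y ∈ Ω k, ((R * M₁ * L ^ (k - 1) : ℕ) : ℤ) < l1dist x y)
    (hR : 2 * d * ρ * L < R * M₁) : tcube L a M ρ k ⊆ Ω (k - 1) := by
  intro x hx
  rw [tcube_eq] at hx
  -- the nearest point of `□`
  set y : Site d := fun i =>
    if x i < (L : ℤ) ^ k * a i then (L : ℤ) ^ k * a i
    else if (L : ℤ) ^ k * (a i + M) - 1 < x i then (L : ℤ) ^ k * (a i + M) - 1 else x i with hy_def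
  have hLk : (1 : ℤ) ≤ (L : ℤ) ^ k := by exact_mod_cast Nat.one_le_pow k L hL
  have hMz : (1 : ℤ) ≤ M := by exact_mod_cast hM
  have hLM : (1 : ℤ) ≤ (L : ℤ) ^ k * M := by nlinarith
  have hyb : y ∈ box L a M k := by
    intro i
    simp only [hy_def, bLo, bHi, Nat.cast_zero, sub_zero, add_zero]
    have e1 : (L : ℤ) ^ k * (a i + M) = (L : ℤ) ^ k * a i + (L : ℤ) ^ k * M := by ring
    split_ifs with h1 h2 <;> constructor <;> linarith
  have hdist : ∀ i, |x i - y i| ≤ (L : ℤ) ^ k * (2 * ρ) := by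
    intro i
    obtain ⟨h1, h2⟩ := hx i
    simp only [bLo, bHi] at h1 h2
    push_cast at h1 h2
    have e1 : (L : ℤ) ^ k * (a i + M) = (L : ℤ) ^ k * a i + (L : ℤ) ^ k * M := by ring
    have hρ0 : (0 : ℤ) ≤ (L : ℤ) ^ k * (2 * ρ) := by positivity
    simp only [hy_def]
    split_ifs with h3 h4
    · rw [abs_le]; constructor <;> linarith
    · rw [abs_le]; constructor <;> linarith
    · simp [hρ0]
  have hsum : l1dist x y ≤ (d : ℤ) * ((L : ℤ) ^ k * (2 * ρ)) := by
    unfold l1dist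
    calc ∑ i, |x i - y i| ≤ ∑ _i : Fin d, (L : ℤ) ^ k * (2 * ρ) := Finset.sum_le_sum fun i _ => hdist i
      _ = (d : ℤ) * ((L : ℤ) ^ k * (2 * ρ)) := by simp [Finset.sum_const]
  by_contra hxΩ
  have h1 := hsep x hxΩ y (hbox hyb)
  obtain ⟨k', rfl⟩ : ∃ k', k = k' + 1 := ⟨k - 1, by omega⟩
  simp only [Nat.add_sub_cancel] at h1
  have hRz : ((2 * d * ρ * L : ℕ) : ℤ) < ((R * M₁ : ℕ) : ℤ) := by exact_mod_cast hR
  push_cast at h1 hRz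
  have hLk' : (0 : ℤ) < (L : ℤ) ^ k' := by positivity
  have h2 : (d : ℤ) * ((L : ℤ) ^ (k' + 1) * (2 * ρ)) = (2 * d * ρ * L) * (L : ℤ) ^ k' := by ring
  have h3 : (2 * (d : ℤ) * ρ * L) * (L : ℤ) ^ k' < (R * M₁ : ℤ) * (L : ℤ) ^ k' :=
    mul_lt_mul_of_pos_right hRz hLk'
  linarith

/-- **"`□_k ⊂ Ω_{k−1}`, `□_j ⊂ Ω_j`, `j < k`"** (p. 99) — and indeed `□_j ⊂ Ω_{k−1}` for every `j ≤ k` — from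
`□̃ ⊂ Ω_{k−1}` and the nesting (1.3) `Ω₀ ⊃ Ω₁ ⊃ … ⊃ Ω_k`. [cite: Balaban1985RegularSpaces, p.99 ("□_k ⊂ Ω_{k-1}, □_j ⊂ Ω_j, j < k"), (1.3) p.77] -/
theorem cube_subset_Omega {L : ℕ} (hL : 2 ≤ L) {a : Site d} {M ρ k : ℕ} (hρ : 1 ≤ ρ) {Ω : ℕ → Set (Site d)}
    (hnest : ∀ j, j < k → Ω (j + 1) ⊆ Ω j) (hT : tcube L a M ρ k ⊆ Ω (k - 1)) :
    (∀ j, j ≤ k → cube L a M ρ k j ⊆ Ω (k - 1)) ∧ (∀ j, j < k → cube L a M ρ k j ⊆ Ω j) := by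
  have h1 : ∀ j, j ≤ k → cube L a M ρ k j ⊆ Ω (k - 1) := fun j hj => (cube_subset_tcube hL hρ hj).trans hT
  refine ⟨h1, fun j hj => (h1 j hj.le).trans ?_⟩
  -- Ω (k - 1) ⊆ Ω j for j ≤ k - 1, by the nesting
  have hmono : ∀ n, ∀ j, j + n ≤ k - 1 → Ω (j + n) ⊆ Ω j := by
    intro n
    induction n with
    | zero => intro j _; simp
    | succ n ih =>
      intro j hjn
      exact (hnest (j + n) (by omega)).trans (ih j (by omega))
  have := hmono (k - 1 - j) j (by omega)
  rwa [show j + (k - 1 - j) = k - 1 by omega] at this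

end Geometry

/-! ## §7. (1.132)/(1.133) for the printed family -/

section Analytic

variable {𝔸 : Type*} [NormedRing 𝔸] [NormOneClass 𝔸] [NormedAlgebra ℂ 𝔸] [CompleteSpace 𝔸]

/-- **(1.132) and (1.133) for the family (1.131)**: for `U₀ ∈ 𝔄_k({Ω_j}, α₀)` (`B8Ineq132.InAk`, `η > 0` free) and
`□̃ ⊂ Ω_{k−1}`, the cut-off configuration `U₀″ = cutFixed` of `B8Ineq133` on the tower over
`□̃^{(k)} = [a − 2R₁M₁, a + M − 1 + 2R₁M₁]^d` (centre `ctr`, any orbit) satisfies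
`U₀″ ∈ 𝔄_k({□_j}, L³α₀)` with `□_j = cube … j`, `U₀″ ∈ Ax_k(ℭ_k, 1)` with `ℭ_k = ⋃ Λ′_j`, `Λ′_j = LamP … j`, and
`|Ū₀″ʲ − 1| < 6dL²Mα₀` for the bonds of `□_j^{(j)} = [sqLo j, sqHi j]`, `j = 0, …, k`.  The geometric hypotheses
`hsq`/`hcol`/`hΛ`/`hy`/`hy'`/`hrad`/`hside`/`hRM` of `B8Ineq132.ineq132` are DISCHARGED by §2–§5 (`R₁M₁ ↦ ρ ≥ 1`,
`M ≥ ρ`); what remains is print's `U₀ ∈ 𝔄_k({Ω_j}, α₀)`, `□̃ ⊂ Ω_{k−1}`, `11d < M` and the smallness of `α₀`.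
[cite: Balaban1985RegularSpaces, (1.131)-(1.133) p.99, p.98] -/
theorem ineq132_cubes (L : ℕ) (hL : 2 ≤ L) (hd : 1 ≤ d) {G : Subgroup 𝔸ˣ} (hG : AvgClosed d L G) (k : ℕ)
    (U : Site d → Fin d → 𝔸ˣ) (hU : ∀ x κ, U x κ ∈ G) {α₀ : ℝ} (hα : 0 < α₀)
    (hα3 : C0 d * (α₀ * (L : ℝ) ^ 2) ≤ 1 / 3) (hα2 : 2 * (α₀ * (L : ℝ) ^ 2) ≤ c2' d L)
    (a : Site d) {M ρ : ℕ} (hρ : 1 ≤ ρ) (hρM : ρ ≤ M) (hM : 11 * (d : ℝ) < M)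
    {η : ℝ} (hη : 0 < η) {Ω : ℕ → Set (Site d)} (hA : InAk L k η α₀ Ω U)
    (hT : tcube L a M ρ k ⊆ Ω (k - 1))
    (hsmall : 11 * (d : ℝ) ^ 2 * (L : ℝ) ^ 2 * α₀ + ((M : ℝ) + 4 * ρ) * d * (L : ℝ) ^ 2 * α₀ ≤ 1 / 6) :
    InAk L k η ((L : ℝ) ^ 3 * α₀) (cube L a M ρ k) (cutFixed L (tLo a ρ) (tHi a M ρ) U k (ctr a M)) ∧
    InAxOne L k (LamP L a M ρ k) (cutFixed L (tLo a ρ) (tHi a M ρ) U k (ctr a M)) ∧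
    ∀ j, j ≤ k → ∀ (x : Site d) (ν : Fin d), sqLo L a ρ k j ≤ x → x + e ν ≤ sqHi L a M ρ k j →
      ‖((avgIter L (cutFixed L (tLo a ρ) (tHi a M ρ) U k (ctr a M)) j x ν : 𝔸ˣ) : 𝔸) - 1‖ <
        6 * d * (L : ℝ) ^ 2 * M * α₀ := by
  have hM1 : 1 ≤ M := hρ.trans hρM
  obtain ⟨hy, hy', hrad⟩ := ctr_mem (a := a) (ρ := ρ) hM1
  have hRM : (ρ : ℝ) * 1 ≤ (M : ℝ) := by rw [mul_one]; exact_mod_cast hρM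
  have hsmall' : 11 * (d : ℝ) ^ 2 * (L : ℝ) ^ 2 * α₀ + ((M : ℝ) + 4 * ρ * 1) * d * (L : ℝ) ^ 2 * α₀ ≤ 1 / 6 := by
    rwa [mul_one]
  have hΩ : ∃ l, l ≤ k ∧ k ≤ l + 1 ∧ ∀ x, InBox (tlo L (tLo a ρ) k) (thi L (tHi a M ρ) k) x → x ∈ Ω l :=
    ⟨k - 1, Nat.sub_le _ _, by omega, fun x hx => hT hx⟩
  have hsq : ∀ j, j ≤ k → ∃ l, l ≤ k ∧ j ≤ l + 1 ∧ cube L a M ρ k j ⊆ Ω l :=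
    fun j hj => ⟨k - 1, Nat.sub_le _ _, by omega, (cube_subset_tcube hL hρ hj).trans hT⟩
  have hcol : ∀ j, j ≤ k → Collar (cube L a M ρ k j) (tlo L (tLo a ρ) k) (thi L (tHi a M ρ) k) :=
    fun j hj => collar_cube hL hρ hj
  obtain ⟨h132a, h132b, h133⟩ := ineq132 L hL hd hG k U hU hα hα3 hα2 (tLo a ρ) (tHi a M ρ) (tLo_le_tHi hM1)
    hη hA hΩ hsq hcol (lamP_subset hL a M ρ k) hy hy' hrad (two_crad_le M ρ) hRM hM hsmall'
  refine ⟨h132a, h132b, fun j hj x ν hx hx' => ?_⟩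
  obtain ⟨h1, h2⟩ := sq_le_tilde hL a M ρ k j
  have h := h133 (k - j) (Nat.sub_le _ _) x ν (fun i => (h1 i).trans (hx i)) (fun i => (hx' i).trans (h2 i))
  rwa [Nat.sub_sub_self hj] at h

/-- The same with print's DERIVATION of `□̃ ⊂ Ω_{k−1}` (§6) in place of the hypothesis: `□ ⊂ Ω_k`, the separation
(1.4) at level `k − 1` (`ℓ¹`, fine units) and "`L⁻¹RM₁ > 2dR₁M₁`", `k ≥ 1`. [cite: Balaban1985RegularSpaces, (1.131)-(1.133) p.99, p.98, (1.4) p.77] -/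
theorem ineq132_cubes_of_sep (L : ℕ) (hL : 2 ≤ L) (hd : 1 ≤ d) {G : Subgroup 𝔸ˣ} (hG : AvgClosed d L G)
    {k : ℕ} (hk : 1 ≤ k) (U : Site d → Fin d → 𝔸ˣ) (hU : ∀ x κ, U x κ ∈ G) {α₀ : ℝ} (hα : 0 < α₀)
    (hα3 : C0 d * (α₀ * (L : ℝ) ^ 2) ≤ 1 / 3) (hα2 : 2 * (α₀ * (L : ℝ) ^ 2) ≤ c2' d L)
    (a : Site d) {M ρ : ℕ} (hρ : 1 ≤ ρ) (hρM : ρ ≤ M) (hM : 11 * (d : ℝ) < M)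
    {η : ℝ} (hη : 0 < η) {Ω : ℕ → Set (Site d)} (hA : InAk L k η α₀ Ω U)
    {R M₁ : ℕ} (hbox : box L a M k ⊆ Ω k)
    (hsep : ∀ x, x ∉ Ω (k - 1) → ∀ y ∈ Ω k, ((R * M₁ * L ^ (k - 1) : ℕ) : ℤ) < l1dist x y)
    (hR : 2 * d * ρ * L < R * M₁)
    (hsmall : 11 * (d : ℝ) ^ 2 * (L : ℝ) ^ 2 * α₀ + ((M : ℝ) + 4 * ρ) * d * (L : ℝ) ^ 2 * α₀ ≤ 1 / 6) :
    InAk L k η ((L : ℝ) ^ 3 * α₀) (cube L a M ρ k) (cutFixed L (tLo a ρ) (tHi a M ρ) U k (ctr a M)) ∧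
    InAxOne L k (LamP L a M ρ k) (cutFixed L (tLo a ρ) (tHi a M ρ) U k (ctr a M)) ∧
    ∀ j, j ≤ k → ∀ (x : Site d) (ν : Fin d), sqLo L a ρ k j ≤ x → x + e ν ≤ sqHi L a M ρ k j →
      ‖((avgIter L (cutFixed L (tLo a ρ) (tHi a M ρ) U k (ctr a M)) j x ν : 𝔸ˣ) : 𝔸) - 1‖ <
        6 * d * (L : ℝ) ^ 2 * M * α₀ :=
  ineq132_cubes L hL hd hG k U hU hα hα3 hα2 a hρ hρM hM hη hA
    (tcube_subset_of_sep (le_trans (by norm_num) hL) hk (hρ.trans hρM) hbox hsep hR) hsmall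

end Analytic

end Literature.MathematicalPhysics.QuantumFieldTheory.Balaban1983to89.B8Eq131Cubes
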